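import Summits.AtomisticToContinuum.HydrodynamicLimit.Theses.OneFlightGossipEngine
import Summits.AtomisticToContinuum.HydrodynamicLimit.Theses.BGEndpointRigidity
import Summits.AtomisticToContinuum.HydrodynamicLimit.Theorems.OneFlightGossipEngineCollisionActivityTailsActMeasurable
import HarnessLib

/-!
# `CollisionActivityTails` (stmt-AtomisticToContinuum-13734), line `plaque-thinning-count-ld`: the collision-by-collision
split of the window activity and the line's composition (shared vocabulary of the line's stub files)

Helper file (`--supports stmt-AtomisticToContinuum-13734`) for the crux
`Summit.AtomisticToContinuum.HydrodynamicLimit.Theses.OneFlightGossipEngine.CollisionActivityTails`. It carries, sorry-free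
and over landed vocabulary (`…ActivityDomination`: `Flow`, `Cfg`, `window`, `act`, `tdist`, `nearCount`; `…NearFieldKineticTails`:
`tailFn`; `…EndpointTails`: `ae_mem_good_localGibbsLaw`), the part of the line's skeleton
(`Cruxes/CollisionActivityTails/Lines/plaque_thinning_count_ld.lean`) that does not depend on the open one-flight input:

* §0 the vocabulary: the global Gibbs reference `gibbs`, the per-collision impulse `imp` (the crux's summand) and relative speed
  `relSpeed`, the multi-scale tagging criterion `Tagged` (`scaleRadius`, `ballKinetic`), and the three pieces of the activity
  `uncAct` (cold, untagged), `tagAct` (cold, tagged), `hotAct` (relative speed above the cap);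
* §1 the four branch statements of the line: `EquilibriumUntaggedActivityLMGF` (target of stub 2, hypothesis of stub 3),
  `UntaggedActivityTails` (target of stub 3), `PreShockEnvelope` (the line's import, stub 4 = item stmt-AtomisticToContinuum-13677
  in the crux's pre-shock frame; `preShockEnvelope_of_lanfordEnvelopeR`), `AbnormalActivityVanishes` (target of stub 5);
* §2 the composition, PROVED: the split is exact on the good set (`act_eq_uncAct_add_tagAct_add_hotAct`), the pathwise tail
  algebra `𝟙{V<a}a ≤ 3(𝟙{V/3<unc}unc + tag + hot)` (`tailFn_act_le_three`), and
  `stub_plaqueComposition : UntaggedActivityTails → AbnormalActivityVanishes → CollisionActivityTails` (registered helper sub-goal of the crux item)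
  (quantifier bookkeeping `σ₀ = min`, `y := y₀(t)`, `V₀ := 3V₀ᵘ(y)`, caps from the abnormal branch at accuracy `ε/9`, one
  `lintegral` split by the a.e.-measurability conjunct of the untagged statement).

The one-flight vocabulary and the dynamical input (stub 1) stay in the skeleton until their statement is settled. Stub files of
the line import THIS file, so that every stub is proved against one copy of the definitions.

References: C. Cercignani, R. Illner, M. Pulvirenti, *The Mathematical Theory of Dilute Gases* (1994), §4.2, App. 4.A
(collision sums along the hard-sphere flow); H. Spohn, *Large Scale Dynamics of Interacting Particles* (1991), Part I §2.3
(local Gibbs states). Elementary bookkeeping; recorded here.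
-/
noncomputable section

open MeasureTheory Set Filter Topology
open scoped ENNReal

namespace Summit.AtomisticToContinuum.HydrodynamicLimit.Theorems.CollisionActivityTailsPlaqueSplit

open Literature.MathematicalPhysics.KineticTheory Literature.Analysis.FluidPDE
open Summit.AtomisticToContinuum.HydrodynamicLimit.Theorems.CollisionActivityTailsActivityDomination
  (Flow Cfg window act tdist nearCount)
open Summit.AtomisticToContinuum.HydrodynamicLimit.Theorems.CollisionActivityTailsNearFieldKineticTails
  (tailFn tailFn_of_lt tailFn_of_le tailFn_nonneg)
open Summit.AtomisticToContinuum.HydrodynamicLimit.Theorems.CollisionActivityTailsEndpointTails (ae_mem_good_localGibbsLaw)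

/-! ## §0 Vocabulary -/

variable {σ : ℝ} {N : ℕ}

/-- The global Gibbs law (constant activity `a₀`, zero drift, temperature `θ₀`) — the equilibrium reference `G_N`. -/
def gibbs (σ a₀ θ₀ : ℝ) (N : ℕ) (Φ : Flow σ N) : Measure (Cfg N) :=
  localGibbsLaw σ (fun _ => a₀) (fun _ => 0) (fun _ => θ₀) N Φ

/-- The collision record of the ordered pair `(k, l)` read off the (post-collisional) configuration `y` at time `t`. -/
abbrev rec (σ : ℝ) (N : ℕ) (y : Cfg N) (t : ℝ) (k l : Fin (N + 1)) : HardSphereCollisionRecord (Fin 3) T3 (N + 1) :=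
  HardSphereCollisionRecord.ofConfig (Torus.geometry (Fin 3)) (hsDiameter σ N) y t k l

/-- The impulse `|v_k⁺ - v_k⁻|` received by the first particle of the ordered contact pair `(k, l)` (the crux's summand). -/
def imp (σ : ℝ) (N : ℕ) (y : Cfg N) (t : ℝ) (k l : Fin (N + 1)) : ℝ :=
  ‖(rec σ N y t k l).postVel.1 - (rec σ N y t k l).preVel.1‖

/-- Relative speed of the pair `(k, l)` in the configuration `y` (equal in norm before and after an elastic collision). -/
def relSpeed (y : Cfg N) (k l : Fin (N + 1)) : ℝ := ‖(y k).2 - (y l).2‖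

/-- Radius of the ball of MEAN occupancy `K'` (unit torus, `N + 1` centres): `(4π/3) r³ (N+1) = K'`. -/
def scaleRadius (N K' : ℕ) : ℝ := (3 * (K' : ℝ) / (4 * Real.pi * ((N : ℝ) + 1))) ^ (1 / 3 : ℝ)

/-- Kinetic energy (twice) carried by the centres within distance `r` of particle `i` (itself included). -/
def ballKinetic (y : Cfg N) (i : Fin (N + 1)) (r : ℝ) : ℝ :=
  ∑ j : Fin (N + 1), if tdist (y j).1 (y i).1 ≤ r then ‖(y j).2‖ ^ 2 else 0

/-- Particle `i` is **tagged** (threshold `y`, minimal scale `K`) in the configuration `cfg`: at some scale `K' ≥ max K 1` the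
ball of mean occupancy `K'` around `i` holds at least `y K'` centres OR kinetic energy at least `y K'` — `i` sits in a
region that is over-dense or over-heated by the factor `y` at a scale holding `≥ K'` mean particles. Instantaneous, multi-scale
(triage r2-2 S1): macroscopic droplets / blobs / hot spots are tagged at their own scale whatever `K`; incidental small clusters
(fewer than `y K` members) are not. Benign degenerate instances: for `y ≤ 1` every particle tags itself (`nearCount ≥ 1`), and for
`y` below twice the mean kinetic energy per particle the whole-torus scales tag everybody — then `uncAct ≡ 0` and the untagged
statements below hold trivially; they are CONSUMED only at the threshold `y₀` produced by `AbnormalActivityVanishes` (large), and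
for `N ≥ N₀ > K` so that local scales `K ≤ K' ≤ N` exist. -/
def Tagged (y : ℝ) (K : ℕ) (cfg : Cfg N) (i : Fin (N + 1)) : Prop :=
  ∃ K' : ℕ, K ≤ K' ∧ 1 ≤ K' ∧
    (y * K' ≤ (nearCount cfg i (scaleRadius N K') : ℝ) ∨ y * K' ≤ ballKinetic cfg i (scaleRadius N K'))

open scoped Classical in
/-- **Untagged cold activity** `uncAct`: `(σ/τ) Σ |Δv_i|` over the collisions of `i` in `(s, s+w]` with relative speed `≤ Θ`
at which `i` is NOT tagged — the recurrent branch the one-flight engine controls. -/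
def uncAct (Θ y : ℝ) (K : ℕ) (Φ : Flow σ N) (τ s : ℝ) (i : Fin (N + 1)) (z : Cfg N) : ℝ :=
  σ / τ * Φ.collisionPairSum (Set.Ioc s (s + window τ N))
    (fun t cfg k l => if k = i ∧ relSpeed cfg k l ≤ Θ ∧ ¬ Tagged y K cfg i then imp σ N cfg t k l else 0) z

open scoped Classical in
/-- **Tagged cold activity** `tagAct`: cold collisions of `i` at which `i` IS tagged (persistent structures' branch). -/
def tagAct (Θ y : ℝ) (K : ℕ) (Φ : Flow σ N) (τ s : ℝ) (i : Fin (N + 1)) (z : Cfg N) : ℝ :=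
  σ / τ * Φ.collisionPairSum (Set.Ioc s (s + window τ N))
    (fun t cfg k l => if k = i ∧ relSpeed cfg k l ≤ Θ ∧ Tagged y K cfg i then imp σ N cfg t k l else 0) z

open scoped Classical in
/-- **Hot activity** `hotAct`: collisions of `i` with relative speed `> Θ` (full impulse). -/
def hotAct (Θ : ℝ) (Φ : Flow σ N) (τ s : ℝ) (i : Fin (N + 1)) (z : Cfg N) : ℝ :=
  σ / τ * Φ.collisionPairSum (Set.Ioc s (s + window τ N))
    (fun t cfg k l => if k = i ∧ ¬ relSpeed cfg k l ≤ Θ then imp σ N cfg t k l else 0) z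

/-! ## §1 The branch statements of the line -/

/-- **EQUILIBRIUM EXPONENTIAL MOMENT OF THE UNTAGGED-ACTIVITY TAIL SUM** (conclusion of stub 2, hypothesis of stub 3): under
the global Gibbs law, for `0 < σ < σ₀` and every tagging threshold `y > 0` there is a level `V₀ = V₀(a₀, θ₀, σ, y)` such that
for `V ≥ V₀`, EVERY cold cap `Θ`, EVERY minimal tagging scale `K`, every `γ > 0` and `δ > 0`, for `τ ≥ τ₀` and
`N ≥ N₀`, all flows and all window starts `s ≥ 0`:
`∫ exp(γ Σ_i 𝟙{V < uncAct_i} uncAct_i) dG_N ≤ exp(δ (N+1))` (with the a.e.-measurability of the tail sum). The order is the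
content: `V₀` before `Θ, K, γ, δ` (a macroscopic warm or dense region is tagged at its own scale, an untagged one has bounded
`density × temperature` hence bounded activity rate; transient sub-scale clusters cost `τ₀(K, Θ)` only), `γ → ∞` admissible
because the equilibrium cost of an untagged activity hub GROWS WITH `τ` (Bennett: `≥ Vτ/(σΘ)` aimed cold arrivals,
each of conditional probability `≤ C min(1,S)` by stub 1, in ONE global filtration so that the exponential supermartingale is a
product over particles — triage r2-1 G1), `s`-uniform by invariance of `G_N`. -/
def EquilibriumUntaggedActivityLMGF : Prop :=
  ∀ (a₀ θ₀ : ℝ), 0 < a₀ → 0 < θ₀ → ∃ σ₀ : ℝ, 0 < σ₀ ∧ ∀ σ : ℝ, 0 < σ → σ < σ₀ →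
    ∀ y : ℝ, 0 < y → ∃ V₀ : ℝ, 0 < V₀ ∧ ∀ V : ℝ, V₀ ≤ V → ∀ Θ : ℝ, 0 < Θ → ∀ K : ℕ,
    ∀ γ : ℝ, 0 < γ → ∀ δ : ℝ, 0 < δ → ∃ τ₀ : ℝ, 0 < τ₀ ∧ ∀ τ : ℝ, τ₀ ≤ τ → ∃ N₀ : ℕ, ∀ N : ℕ, N₀ ≤ N →
    ∀ (Φ : Flow σ N) (s : ℝ), 0 ≤ s →
      AEMeasurable (fun z => ∑ i : Fin (N + 1), tailFn V (uncAct Θ y K Φ τ s i z)) (gibbs σ a₀ θ₀ N Φ) ∧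
      ∫⁻ z, ENNReal.ofReal (Real.exp (γ * ∑ i : Fin (N + 1), tailFn V (uncAct Θ y K Φ τ s i z)))
          ∂(gibbs σ a₀ θ₀ N Φ) ≤ ENNReal.ofReal (Real.exp (δ * ((N : ℝ) + 1)))

/-- **UNTAGGED ACTIVITY TAILS under the true law** (conclusion of stub 3; first hypothesis of the composition): the crux's
own frame and quantifier shape for the untagged cold activity `uncAct Θ y K`, with the tagging threshold `y` fixed BEFORE the
level `V₀ = V₀(y)` and the caps `Θ, K` fixed AFTER the level and before `τ₀` (they only delay `τ₀`). Obtained from the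
equilibrium exponential moment by the entropy inequality AT TIME ZERO against the global Gibbs reference `G_N` with
`θ_ref > sup θ₀`: `E_{λ₀}[(N+1)⁻¹ Σ tail] ≤ (H(λ₀|G_N)/(N+1) + δ)/γ ≤ (κ + δ)/γ`, `γ → ∞` after `τ → ∞` — legitimate ONLY
because the equilibrium per-hub cost grows with `τ` (outside the CountingCeiling, whose families are tagged). Carries the
a.e.-measurability of the tail sum (the composition splits one `lintegral`). -/
def UntaggedActivityTails : Prop :=
  ∀ (a₀ θ₀ : T3 → ℝ) (u₀ : T3 → V3), Continuous a₀ → Continuous θ₀ → Continuous u₀ →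
    (∀ x, 0 < a₀ x) → (∀ x, 0 < θ₀ x) → ∃ σ₀ : ℝ, 0 < σ₀ ∧ ∀ σ : ℝ, 0 < σ → σ < σ₀ →
    ∀ (T : ℝ) (ρ θ : ℝ → T3 → ℝ) (u : ℝ → T3 → V3), IsHardSphereEulerSolution σ T ρ u θ →
    ∀ Φ : (N : ℕ) → Flow σ N,
    TendstoHydroFieldsAt (fun N => localGibbsLaw σ a₀ u₀ θ₀ N (Φ N)) Φ ρ u θ 0 →
    ∀ t ∈ Set.Ico 0 T, ∀ y : ℝ, 0 < y → ∃ V₀ : ℝ, 0 < V₀ ∧ ∀ V : ℝ, V₀ ≤ V → ∀ Θ : ℝ, 0 < Θ → ∀ K : ℕ,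
    ∀ η : ℝ, 0 < η → ∃ τ₀ : ℝ, 0 < τ₀ ∧ ∀ τ : ℝ, τ₀ ≤ τ → ∃ N₀ : ℕ, ∀ N : ℕ, N₀ ≤ N → ∀ s ∈ Set.Icc 0 t,
      AEMeasurable (fun z => ∑ i : Fin (N + 1), tailFn V (uncAct Θ y K (Φ N) τ s i z))
          (localGibbsLaw σ a₀ u₀ θ₀ N (Φ N)) ∧
      ∫⁻ z, ENNReal.ofReal (((N : ℝ) + 1)⁻¹ * ∑ i : Fin (N + 1), tailFn V (uncAct Θ y K (Φ N) τ s i z))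
        ∂(localGibbsLaw σ a₀ u₀ θ₀ N (Φ N)) ≤ ENNReal.ofReal η

/-- **STUB 4 — PRE-SHOCK CORRELATION ENVELOPE** (the line's one IMPORT; item 13677 `BGEndpointRigidity.LanfordEnvelopeR`
restricted to 13734's quantifier frame: classical hs-Euler solution on `[0,T)`, `t = 0` LLN, times `r ≤ t < T` only —
`preShockEnvelope_of_lanfordEnvelopeR`; the post-shock horizons of 13677, where focusing may break every fixed Gaussian
envelope, are NOT asked for). For every `t < T` there are `β > 0` and `C` with: for all `N`, all orders `k` and all
`r ∈ [0, t]`, for a.e. `Z_k` the `k`-particle volume-marginal of `𝟙_{D_ε} · (W ∘ Φ_{-r})` (the density of the true law at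
time `r`) is `≤ C^k exp(-β E(Z_k))`. This is the (N2) residual of the crux — window-PERSISTENT dense droplets, blobs and hot
spots under the true pre-shock law — in its weakest consumable dress (instantaneous, bounded-order counting); no mechanism of
this line bears on it (triage r2-1 S5 / r2-2 S2 / r2-3 S4: honest bookkeeping, not a costume stub). -/
def PreShockEnvelope : Prop :=
  ∀ (a₀ θ₀ : T3 → ℝ) (u₀ : T3 → V3), Continuous a₀ → Continuous θ₀ → Continuous u₀ →
    (∀ x, 0 < a₀ x) → (∀ x, 0 < θ₀ x) → ∃ σ₀ : ℝ, 0 < σ₀ ∧ ∀ σ : ℝ, 0 < σ → σ < σ₀ →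
    ∀ (T : ℝ) (ρ θ : ℝ → T3 → ℝ) (u : ℝ → T3 → V3), IsHardSphereEulerSolution σ T ρ u θ →
    ∀ Φ : (N : ℕ) → Flow σ N,
    TendstoHydroFieldsAt (fun N => localGibbsLaw σ a₀ u₀ θ₀ N (Φ N)) Φ ρ u θ 0 →
    ∀ t ∈ Set.Ico 0 T, ∃ β C : ℝ, 0 < β ∧ ∀ (N : ℕ) (k : ℕ), ∀ r ∈ Set.Icc 0 t,
      ∀ᵐ Zk : Config k (Fin 3) T3,
        |nthMarginal (N + 1) k ((hardSphereDomain (Torus.geometry (Fin 3)) (N + 1) (hsDiameter σ N)).indicator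
            (hsTransport (Φ N) r (canonicalDensity (Torus.geometry (Fin 3)) (hsDiameter σ N) (N + 1)
              (localGibbsProfile a₀ u₀ θ₀)))) Zk| ≤ C ^ k * Real.exp (-(β * configEnergy Zk))

/-- **ABNORMAL ACTIVITY VANISHES IN MEAN** (conclusion of stub 5; second hypothesis of the composition): under the true
pre-shock law, for every `t < T` there is a tagging threshold `y₀` (from the envelope constants) such that for `y ≥ y₀` and
every accuracy `η` there are a cold cap `Θ` and a minimal tagging scale `K` with: for EVERY `τ > 0`, `N ≥ N₀(τ)` and all
starts `s ≤ t`, `E_{λ₀}[(N+1)⁻¹ Σ_i (tagAct_i + hotAct_i)] ≤ η`. Mechanism: both pieces are expected MARKED COLLISION FLUXES —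
hot: two-point flux with weight `|g| 𝟙{|g| > Θ}`, Gaussian-small in `Θ`; tagged at scale `K'`: `(⌈yK'⌉+1)`-point flux,
`≤ (C K')^{yK'}/(yK')! ≍ (eC/y)^{yK'}`, geometric in `K'` once `y > eC`, summed over `K' ≥ K` — from the a.e. marginal
bounds of `PreShockEnvelope` at `t' = (t+T)/2` via the collision-cylinder identity (CIP94 §4.3; GST2013 Ch. 4); the factor
`σ/τ × window = σ ℓ_N` makes the bound `τ`-uniform. -/
def AbnormalActivityVanishes : Prop :=
  ∀ (a₀ θ₀ : T3 → ℝ) (u₀ : T3 → V3), Continuous a₀ → Continuous θ₀ → Continuous u₀ →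
    (∀ x, 0 < a₀ x) → (∀ x, 0 < θ₀ x) → ∃ σ₀ : ℝ, 0 < σ₀ ∧ ∀ σ : ℝ, 0 < σ → σ < σ₀ →
    ∀ (T : ℝ) (ρ θ : ℝ → T3 → ℝ) (u : ℝ → T3 → V3), IsHardSphereEulerSolution σ T ρ u θ →
    ∀ Φ : (N : ℕ) → Flow σ N,
    TendstoHydroFieldsAt (fun N => localGibbsLaw σ a₀ u₀ θ₀ N (Φ N)) Φ ρ u θ 0 →
    ∀ t ∈ Set.Ico 0 T, ∃ y₀ : ℝ, 0 < y₀ ∧ ∀ y : ℝ, y₀ ≤ y → ∀ η : ℝ, 0 < η →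
    ∃ Θ : ℝ, 0 < Θ ∧ ∃ K : ℕ, ∀ τ : ℝ, 0 < τ → ∃ N₀ : ℕ, ∀ N : ℕ, N₀ ≤ N → ∀ s ∈ Set.Icc 0 t,
      ∫⁻ z, ENNReal.ofReal (((N : ℝ) + 1)⁻¹ *
          ∑ i : Fin (N + 1), (tagAct Θ y K (Φ N) τ s i z + hotAct Θ (Φ N) τ s i z))
        ∂(localGibbsLaw σ a₀ u₀ θ₀ N (Φ N)) ≤ ENNReal.ofReal η

/-! ### The import is discharged by item 13677 -/

/-- `LanfordEnvelopeR` (stmt-AtomisticToContinuum-13677, route BGEndpointRigidity) implies the pre-shock envelope: drop the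
Euler/LLN hypotheses and apply it on the horizon `t + 1`. -/
theorem preShockEnvelope_of_lanfordEnvelopeR
    (h : Summit.AtomisticToContinuum.HydrodynamicLimit.Theses.BGEndpointRigidity.LanfordEnvelopeR) :
    PreShockEnvelope := by
  intro a₀ θ₀ u₀ ha hθ hu ha0 hθ0
  obtain ⟨σ₀, hσ₀, h⟩ := h a₀ θ₀ u₀ ha hθ hu ha0 hθ0
  refine ⟨σ₀, hσ₀, fun σ hσ hσlt T ρ θ u _ Φ _ t ht => ?_⟩
  obtain ⟨β, C, hβ, h⟩ := h σ hσ hσlt (t + 1) (by linarith [ht.1])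
  refine ⟨β, C, hβ, fun N k r hr => ?_⟩
  exact h N (Φ N) k r ⟨hr.1, hr.2.trans (by linarith)⟩

/-! ## §2 The composition -/

section Composition

variable {σ : ℝ} {N : ℕ}

/-- The impulse is nonnegative. -/
theorem imp_nonneg (y : Cfg N) (t : ℝ) (k l : Fin (N + 1)) : 0 ≤ imp σ N y t k l := norm_nonneg _

/-- The untagged cold activity is nonnegative (`σ, τ ≥ 0`). -/
theorem uncAct_nonneg (hσ : 0 ≤ σ) {Θ y : ℝ} {K : ℕ} (Φ : Flow σ N) {τ : ℝ} (hτ : 0 ≤ τ) (s : ℝ)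
    (i : Fin (N + 1)) (z : Cfg N) : 0 ≤ uncAct Θ y K Φ τ s i z := by
  classical
  unfold uncAct
  refine mul_nonneg (div_nonneg hσ hτ) (Summit.AtomisticToContinuum.HydrodynamicLimit.Theorems.CollisionActivityTailsActivityDomination.collisionPairSum_nonneg
    Φ _ (fun t cfg k l => ?_) z)
  split_ifs
  · exact imp_nonneg _ _ _ _
  · exact le_rfl

/-- The tagged cold activity is nonnegative (`σ, τ ≥ 0`). -/
theorem tagAct_nonneg (hσ : 0 ≤ σ) {Θ y : ℝ} {K : ℕ} (Φ : Flow σ N) {τ : ℝ} (hτ : 0 ≤ τ) (s : ℝ)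
    (i : Fin (N + 1)) (z : Cfg N) : 0 ≤ tagAct Θ y K Φ τ s i z := by
  classical
  unfold tagAct
  refine mul_nonneg (div_nonneg hσ hτ) (Summit.AtomisticToContinuum.HydrodynamicLimit.Theorems.CollisionActivityTailsActivityDomination.collisionPairSum_nonneg
    Φ _ (fun t cfg k l => ?_) z)
  split_ifs
  · exact imp_nonneg _ _ _ _
  · exact le_rfl

/-- The hot activity is nonnegative (`σ, τ ≥ 0`). -/
theorem hotAct_nonneg (hσ : 0 ≤ σ) {Θ : ℝ} (Φ : Flow σ N) {τ : ℝ} (hτ : 0 ≤ τ) (s : ℝ)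
    (i : Fin (N + 1)) (z : Cfg N) : 0 ≤ hotAct Θ Φ τ s i z := by
  classical
  unfold hotAct
  refine mul_nonneg (div_nonneg hσ hτ) (Summit.AtomisticToContinuum.HydrodynamicLimit.Theorems.CollisionActivityTailsActivityDomination.collisionPairSum_nonneg
    Φ _ (fun t cfg k l => ?_) z)
  split_ifs
  · exact imp_nonneg _ _ _ _
  · exact le_rfl

/-- Pointwise bookkeeping of the split: `[P] x = [P ∧ Q ∧ ¬R] x + [P ∧ Q ∧ R] x + [P ∧ ¬Q] x` (any decidability instances). -/
theorem ite_split3 {P Q R : Prop} [Decidable P] [Decidable (P ∧ Q ∧ ¬ R)] [Decidable (P ∧ Q ∧ R)] [Decidable (P ∧ ¬ Q)]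
    (x : ℝ) :
    (if P then x else 0) =
      (if P ∧ Q ∧ ¬ R then x else 0) + (if P ∧ Q ∧ R then x else 0) + (if P ∧ ¬ Q then x else 0) := by
  by_cases hP : P
  · by_cases hQ : Q
    · by_cases hR : R
      · rw [if_pos hP, if_neg (fun h => h.2.2 hR), if_pos ⟨hP, hQ, hR⟩, if_neg (fun h => h.2 hQ)]; ring
      · rw [if_pos hP, if_pos ⟨hP, hQ, hR⟩, if_neg (fun h => hR h.2.2), if_neg (fun h => h.2 hQ)]; ring
    · rw [if_pos hP, if_neg (fun h => hQ h.2.1), if_neg (fun h => hQ h.2.1), if_pos ⟨hP, hQ⟩]; ring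
  · rw [if_neg hP, if_neg (fun h => hP h.1), if_neg (fun h => hP h.1), if_neg (fun h => hP h.1)]; ring

/-- **The collision-by-collision split is exact on the good set**: `a_i = uncAct_i + tagAct_i + hotAct_i`. -/
theorem act_eq_uncAct_add_tagAct_add_hotAct (Θ y : ℝ) (K : ℕ) (Φ : Flow σ N) (τ s : ℝ) (i : Fin (N + 1))
    {z : Cfg N} (hz : z ∈ Φ.good) :
    act Φ τ s i z = uncAct Θ y K Φ τ s i z + tagAct Θ y K Φ τ s i z + hotAct Θ Φ τ s i z := by
  classical
  have hfin : (collisionTimes (Torus.geometry (Fin 3)) (hsDiameter σ N) (fun t => Φ.flow t z) ∩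
      Set.Ioc s (s + window τ N)).Finite :=
    Φ.finite_collisionTimes_inter hz Set.Ioc_subset_Icc_self
  unfold act uncAct tagAct hotAct HardSphereFlow.collisionSum HardSphereFlow.collisionPairSum
    Literature.Analysis.FluidPDE.collisionSum
  rw [← mul_add, ← mul_add, ← collisionPairSum_add hfin, ← collisionPairSum_add hfin]
  congr 1
  unfold Literature.Analysis.FluidPDE.collisionPairSum
  refine finsum_congr fun t => finsum_congr fun _ => Finset.sum_congr rfl fun p _ => ?_
  exact ite_split3 _

/-- Three-term tail algebra with two untailed summands: if `0 ≤ x₁, x₂, x₃` and `a ≤ x₁ + x₂ + x₃` then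
`𝟙{V < a} a ≤ 3 (𝟙{V/3 < x₁} x₁ + x₂ + x₃)` (on `{V < a}` with `x₁ ≤ V/3`, two thirds of `a` sit in `x₂ + x₃`). -/
theorem tailFn_le_three_mul_tail_add {V a x₁ x₂ x₃ : ℝ} (h₁ : 0 ≤ x₁) (h₂ : 0 ≤ x₂) (h₃ : 0 ≤ x₃)
    (ha : a ≤ x₁ + x₂ + x₃) : tailFn V a ≤ 3 * (tailFn (V / 3) x₁ + x₂ + x₃) := by
  by_cases hVa : V < a
  · rw [tailFn_of_lt hVa]
    by_cases hx : V / 3 < x₁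
    · rw [tailFn_of_lt hx]
      linarith
    · rw [tailFn_of_le (not_lt.1 hx)]
      linarith [not_lt.1 hx]
  · rw [tailFn_of_le (not_lt.1 hVa)]
    have := tailFn_nonneg (V := V / 3) h₁
    positivity

/-- Pathwise tail algebra on the good set: `𝟙{V < a_i} a_i ≤ 3 (𝟙{V/3 < unc_i} unc_i + tag_i + hot_i)`. -/
theorem tailFn_act_le_three (hσ : 0 ≤ σ) {Θ y : ℝ} {K : ℕ} (Φ : Flow σ N) {τ : ℝ} (hτ : 0 ≤ τ) (s : ℝ)
    (i : Fin (N + 1)) {z : Cfg N} (hz : z ∈ Φ.good) (V : ℝ) :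
    tailFn V (act Φ τ s i z) ≤
      3 * (tailFn (V / 3) (uncAct Θ y K Φ τ s i z) + tagAct Θ y K Φ τ s i z + hotAct Θ Φ τ s i z) :=
  tailFn_le_three_mul_tail_add (uncAct_nonneg hσ Φ hτ s i z) (tagAct_nonneg hσ Φ hτ s i z)
    (hotAct_nonneg hσ Φ hτ s i z) (act_eq_uncAct_add_tagAct_add_hotAct Θ y K Φ τ s i hz).le

/-- Splitting `∫⁻ ofReal (c (A₁ + A₂))` when `A₁` is a.e.-measurable and `c ≥ 0`. -/
theorem lintegral_ofReal_mul_add_le {α : Type*} [MeasurableSpace α] {μ : Measure α}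
    {A₁ A₂ : α → ℝ} {c : ℝ} (hc : 0 ≤ c) (h₁ : AEMeasurable A₁ μ) :
    ∫⁻ x, ENNReal.ofReal (c * (A₁ x + A₂ x)) ∂μ ≤
      ENNReal.ofReal c * (∫⁻ x, ENNReal.ofReal (A₁ x) ∂μ + ∫⁻ x, ENNReal.ofReal (A₂ x) ∂μ) := by
  have hm₁ : AEMeasurable (fun x => ENNReal.ofReal (A₁ x)) μ := h₁.ennreal_ofReal
  calc ∫⁻ x, ENNReal.ofReal (c * (A₁ x + A₂ x)) ∂μ
      ≤ ∫⁻ x, ENNReal.ofReal c * (ENNReal.ofReal (A₁ x) + ENNReal.ofReal (A₂ x)) ∂μ := by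
        refine lintegral_mono fun x => ?_
        rw [ENNReal.ofReal_mul hc]
        exact mul_le_mul_right ENNReal.ofReal_add_le _
    _ = ENNReal.ofReal c * ∫⁻ x, (ENNReal.ofReal (A₁ x) + ENNReal.ofReal (A₂ x)) ∂μ :=
        lintegral_const_mul' _ _ ENNReal.ofReal_ne_top
    _ = ENNReal.ofReal c * (∫⁻ x, ENNReal.ofReal (A₁ x) ∂μ + ∫⁻ x, ENNReal.ofReal (A₂ x) ∂μ) := by
        rw [lintegral_add_left' hm₁]

/-- **COMPOSITION (importable)** — the untagged tail statement and the abnormal-mean statement imply the crux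
`OneFlightGossipEngine.CollisionActivityTails`, concluded BY NAME (its body is the tail statement of `act`, up to `let`s and the
unfolding of `act`/`window`). Quantifier bookkeeping: `σ₀ = min`; `y := y₀(t)` from the
abnormal branch; `V₀ := 3 V₀ᵘ(y)`; given `V, ε`: `Θ, K` from the abnormal branch at accuracy `ε/9`, then `τ₀` from the
untagged branch at level `V/3`, caps `Θ, K`, accuracy `ε/9`; `N₀ = max`; pathwise `𝟙{V<a}a ≤ 3(tail_{V/3} unc + tag + hot)`
on the good set (a.e.), one `lintegral` split (measurability of the untagged tail sum), `3(ε/9 + ε/9) ≤ ε`. -/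
theorem stub_plaqueComposition : UntaggedActivityTails → AbnormalActivityVanishes →
    Summit.AtomisticToContinuum.HydrodynamicLimit.Theses.OneFlightGossipEngine.CollisionActivityTails := by
  intro hU hR a₀ θ₀ u₀ ha hθ hu ha0 hθ0
  obtain ⟨σ₁, hσ₁, hU⟩ := hU a₀ θ₀ u₀ ha hθ hu ha0 hθ0
  obtain ⟨σ₂, hσ₂, hR⟩ := hR a₀ θ₀ u₀ ha hθ hu ha0 hθ0
  refine ⟨min σ₁ σ₂, lt_min hσ₁ hσ₂, ?_⟩
  intro σ hσ hσlt T ρ θ u hsol Φ hLLN t ht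
  have hσ₁' : σ < σ₁ := hσlt.trans_le (min_le_left _ _)
  have hσ₂' : σ < σ₂ := hσlt.trans_le (min_le_right _ _)
  obtain ⟨y₀, hy₀, hR⟩ := hR σ hσ hσ₂' T ρ θ u hsol Φ hLLN t ht
  obtain ⟨V₀, hV₀, hU⟩ := hU σ hσ hσ₁' T ρ θ u hsol Φ hLLN t ht y₀ hy₀
  refine ⟨3 * V₀, by positivity, ?_⟩
  intro V hV ε hε
  have hε9 : 0 < ε / 9 := by positivity
  obtain ⟨Θ, hΘ, K, hR⟩ := hR y₀ le_rfl (ε / 9) hε9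
  obtain ⟨τ₀, hτ₀, hU⟩ := hU (V / 3) (by linarith) Θ hΘ K (ε / 9) hε9
  refine ⟨τ₀, hτ₀, fun τ hτ => ?_⟩
  have hτpos : 0 < τ := hτ₀.trans_le hτ
  obtain ⟨N₁, hU⟩ := hU τ hτ
  obtain ⟨N₂, hR⟩ := hR τ hτpos
  refine ⟨max N₁ N₂, fun N hN s hs => ?_⟩
  -- the crux body: `let w; let P; let act; ∫⁻ … ≤ …` — zeta-reduce and fold the landed `act` / `window`
  show ∫⁻ z, ENNReal.ofReal (((N : ℝ) + 1)⁻¹ * ∑ i : Fin (N + 1), tailFn V (act (Φ N) τ s i z))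
      ∂(localGibbsLaw σ a₀ u₀ θ₀ N (Φ N)) ≤ ENNReal.ofReal ε
  obtain ⟨hmeas, hUb⟩ := hU N (le_of_max_le_left hN) s hs
  have hRb := hR N (le_of_max_le_right hN) s hs
  set P := localGibbsLaw σ a₀ u₀ θ₀ N (Φ N) with hP
  -- pathwise bound, a.e. (the local Gibbs law is carried by the good set)
  have hN1 : (0 : ℝ) < (N : ℝ) + 1 := by positivity
  have hae : ∀ᵐ z ∂P,
      ((N : ℝ) + 1)⁻¹ * ∑ i : Fin (N + 1), tailFn V (act (Φ N) τ s i z) ≤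
        3 * ((((N : ℝ) + 1)⁻¹ * ∑ i : Fin (N + 1), tailFn (V / 3) (uncAct Θ y₀ K (Φ N) τ s i z)) +
          (((N : ℝ) + 1)⁻¹ * ∑ i : Fin (N + 1),
            (tagAct Θ y₀ K (Φ N) τ s i z + hotAct Θ (Φ N) τ s i z))) := by
    filter_upwards [ae_mem_good_localGibbsLaw σ a₀ θ₀ u₀ N (Φ N)] with z hz
    have hpt : ∀ i : Fin (N + 1), tailFn V (act (Φ N) τ s i z) ≤
        3 * (tailFn (V / 3) (uncAct Θ y₀ K (Φ N) τ s i z) +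
          (tagAct Θ y₀ K (Φ N) τ s i z + hotAct Θ (Φ N) τ s i z)) := fun i => by
      have := tailFn_act_le_three hσ.le (Θ := Θ) (y := y₀) (K := K) (Φ N) hτpos.le s i hz V
      linarith
    have hsum := Finset.sum_le_sum fun i (_ : i ∈ Finset.univ) => hpt i
    rw [← Finset.mul_sum, Finset.sum_add_distrib] at hsum
    have hinv : 0 ≤ ((N : ℝ) + 1)⁻¹ := inv_nonneg.2 hN1.le
    have := mul_le_mul_of_nonneg_left hsum hinv
    nlinarith [this]
  -- integrate
  have hmeas' : AEMeasurable
      (fun z => ((N : ℝ) + 1)⁻¹ * ∑ i : Fin (N + 1), tailFn (V / 3) (uncAct Θ y₀ K (Φ N) τ s i z)) P :=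
    hmeas.const_mul _
  calc ∫⁻ z, ENNReal.ofReal (((N : ℝ) + 1)⁻¹ * ∑ i : Fin (N + 1), tailFn V (act (Φ N) τ s i z)) ∂P
      ≤ ∫⁻ z, ENNReal.ofReal (3 * ((((N : ℝ) + 1)⁻¹ *
            ∑ i : Fin (N + 1), tailFn (V / 3) (uncAct Θ y₀ K (Φ N) τ s i z)) +
          (((N : ℝ) + 1)⁻¹ * ∑ i : Fin (N + 1),
            (tagAct Θ y₀ K (Φ N) τ s i z + hotAct Θ (Φ N) τ s i z)))) ∂P :=
        lintegral_mono_ae (hae.mono fun z hz => ENNReal.ofReal_le_ofReal hz)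
    _ ≤ ENNReal.ofReal 3 * (∫⁻ z, ENNReal.ofReal (((N : ℝ) + 1)⁻¹ *
            ∑ i : Fin (N + 1), tailFn (V / 3) (uncAct Θ y₀ K (Φ N) τ s i z)) ∂P +
          ∫⁻ z, ENNReal.ofReal (((N : ℝ) + 1)⁻¹ * ∑ i : Fin (N + 1),
            (tagAct Θ y₀ K (Φ N) τ s i z + hotAct Θ (Φ N) τ s i z)) ∂P) :=
        lintegral_ofReal_mul_add_le (by norm_num) hmeas'
    _ ≤ ENNReal.ofReal 3 * (ENNReal.ofReal (ε / 9) + ENNReal.ofReal (ε / 9)) := by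
        gcongr
    _ = ENNReal.ofReal (3 * (ε / 9 + ε / 9)) := by
        rw [← ENNReal.ofReal_add hε9.le hε9.le, ← ENNReal.ofReal_mul (by norm_num)]
    _ ≤ ENNReal.ofReal ε := ENNReal.ofReal_le_ofReal (by linarith)

end Composition

/-- **Envelope on a horizon** (appended, cycle 1): the body of `PreShockEnvelope` behind its quantifier prefix, for ONE profile triple, ONE reduced
diameter and ONE flow family, with the constants exposed — the hypothesis of the local typing of stub 5 (`…PlaqueSplitDilute`). -/
def EnvelopeOn (σ : ℝ) (a₀ θ₀ : T3 → ℝ) (u₀ : T3 → V3) (Φ : (N : ℕ) → Flow σ N) (t₁ β C : ℝ) : Prop :=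
  ∀ (N k : ℕ), ∀ r ∈ Set.Icc 0 t₁, ∀ᵐ Zk : Config k (Fin 3) T3,
    |nthMarginal (N + 1) k ((hardSphereDomain (Torus.geometry (Fin 3)) (N + 1) (hsDiameter σ N)).indicator
        (hsTransport (Φ N) r (canonicalDensity (Torus.geometry (Fin 3)) (hsDiameter σ N) (N + 1)
          (localGibbsProfile a₀ u₀ θ₀)))) Zk| ≤ C ^ k * Real.exp (-(β * configEnergy Zk))

end Summit.AtomisticToContinuum.HydrodynamicLimit.Theorems.CollisionActivityTailsPlaqueSplit

end
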